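import Literature.Computability.Complexity.FoldBricks
import Literature.Computability.Complexity.StackBricksStrings
import Literature.Computability.Complexity.KannanLanguage
import Literature.Computability.Complexity.StackWordArith
import Literature.Computability.QuantumComplexity.BosonReductionCodes
import HarnessLib

/-!
# Exact BosonSampling: the reduction maps of AA13 Thm. 1.1 as polynomial-time string functions

Family `quantum-advantage`; sequel of `BosonReductionCodes.lean` (the instance codes as explicit
strings) in the `FP`-algebra of `BrickAlgebra.lean` / `HashBricks.lean` / `FoldBricks.lean`.
Source: S. Aaronson, A. Arkhipov, *The computational complexity of linear optics*, Theory of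
Computing 9 (2013), proof of Thm. 1.1 (p. 178): given a `Per²`-query `⟨⟨⟨X⟩, 1ᵏ⟩, u⟩` (an integer
matrix `X`, a confidence parameter, coins), (i) write down the BosonSampling instance whose planted
outcome has probability `∝ Per(X)²` ("Let us feed `A` as input to `𝒪`", eqs. (4.20)–(4.23); here the
exact-dyadic Gram completion of `ExactBosonSamplingHardness.lean` at precision `t = 3 |⟨X⟩|`,
admissible by `BosonCodes.pairDiag_le_four_pow`), (ii) ask a Stockmeyer counter for the number of
coin strings on which the sampler outputs the planted outcome ("by Theorem 4.1, we can approximate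
`p_A`"), (iii) rescale the count (eq. (4.23) inverted). AA13 and Lemma 4.4 ("`U` can be computed in
polynomial time given `X`") take the polynomial running time of these maps for granted; this file
proves it on Mathlib's `TM2` model, by *defining* the three maps as compositions of `FP` bricks and
computing their values on well-formed queries:

* **`BosonFP.bPre`** (`bPre_apply`, `bPre_mem_FP`): `⟨X⟩ ↦ ⟨x₀, y₀⟩` with
  `x₀ = gramInstanceCode (Matrix.of X) (3|⟨X⟩|)`, `y₀ = diagOutcomeCode n (3|⟨X⟩|)`. The machine pads
  the matrix code to the context `⟨q, 1^{|q|³}⟩` (`mkCtx`; the pad makes every emitted piece "linear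
  in the first field", the growth discipline of `loopFn_mem_FP`), reads entries with `nthItemFn`
  (`entryF`), computes the Gram sums as two natural sums `P`, `Q` by sign (`gramPF`, `gramQF`, folds
  of `addFn`; `gramZF = intCode (P − Q)` by `BosonCodes.intCode_sub`), the diagonal entries
  `pairDiagF`, the deficits `defF = bin (4ᵗ − pairDiag)` and their base-`4` digits (`digitBitF`, by
  `divFn`/`remFn`), the three kinds of cells (`cellXF`, `cellPF`, `cellVF`, one-bit branches), rows
  (`rowFrF`) and the three row blocks (`partXF`, `partPF`, `partVF`, nested concatenation folds
  `cmapF`), and finally the headers (`x0F`, `y0F`); the values are identified with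
  `BosonCodes.gramInstanceCode_eq` / `diagOutcomeCode_eq`. Every loop is a `Brick.foldLoop` with a
  clipped piece function (`Brick.clipF`), so `FP`-membership is by composition (`…_mem_FP`), and the
  size estimates (`length_cell_le`, `length_rowFrame_le`, …) only show that clipping is the identity
  on the intended inputs.
* **`BosonFP.bQuery qA cS`** (`bQuery_apply`, `bQuery_mem_FP`): the count query
  `countQuery ⟨x₀,y₀⟩ m 1 k (u ↾ ℓ')`, `m = qA |x₀|` (the sampler's coins), `ℓ' = cS (|⟨x₀,y₀⟩| + m + 1 + k)`
  (the counter's coins) — the shape consumed by `stockmeyerApproxCounting`.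
* **`BosonFP.bPost qA`** (`bPost_apply`, `bPost_mem_FP`): `⟨w, a⟩ ↦ bin ⌈(N/2ᵐ) 4^{tn} n!⌉`,
  `N = decodeNat a` for an *arbitrary* answer string `a` (Mathlib's `decodeNat` reads non-canonical
  numerals too; `Brick.canonF`), `= bin (bosonRescale n t N m)` (`nat_ceil_div_two_pow`).

These maps replace `bosonPre` / `bosonCountQuery` / `bosonCountPost` of
`ExactBosonSamplingHardness.lean` (pinned to `gramPrecision X` and to the junk conventions of
`encodingIntMatrix.decode`), whose `FP`-membership `bosonReduction_mem_FP` is *not* discharged; the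
corrected S20 is re-assembled on the new maps in `BosonReductionAssembly.lean`.

## References

* S. Aaronson, A. Arkhipov, *The computational complexity of linear optics*, Theory of Computing 9
  (2013), Lemma 4.4 and proof of Thm. 1.1, eqs. (4.20)–(4.23) (p. 178); Def. 2.4 (p. 163).
* S. Arora, B. Barak, *Computational Complexity: A Modern Approach*, CUP 2009, §1.3 (polynomial
  time is closed under composition and polynomially bounded loops), §0.1 (codes of tuples).
-/


namespace Literature.Computability.QuantumComplexity

namespace BosonFP

open _root_.Computability Polynomial Literature.Computability.Complexity Literature.Computability.Complexity.OracleCompose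
  Literature.Computability.Complexity.Brick Literature.Computability.Complexity.Plumb
  Literature.Computability.Complexity.HashBricks BosonCodes Finset

variable {n : ℕ}

/-! ### The query's matrix code, the padded context, accessors -/

/-- The matrix code of the query: `⟨bin n, ⟨1ⁿ, body rows⟩⟩`. [folklore] -/
abbrev qcode (M : Fin n → Fin n → ℤ) : List Bool := encodingIntMatrix.encode ⟨n, M⟩

/-- The code of row `i` inside the matrix code. [folklore] -/
def rowOf (M : Fin n → Fin n → ℤ) (i : Fin n) : List Bool :=
  boolPair (ones n) (body (List.ofFn fun j : Fin n => intCode (M i j)))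

/-- The matrix code as nested pairs. [folklore] -/
theorem qcode_eq (M : Fin n → Fin n → ℤ) :
    qcode M = boolPair (encodeNat n) (boolPair (ones n) (body (List.ofFn (rowOf M)))) :=
  encode_matrix_eq M

/-- `|⟨M⟩| = codeLen M`. [folklore] -/
theorem length_qcode (M : Fin n → Fin n → ℤ) : (qcode M).length = codeLen M := rfl

/-- The precision used by the machine: `t = 3 |⟨M⟩|`. [folklore] -/
def tOf (M : Fin n → Fin n → ℤ) : ℕ := 3 * codeLen M

/-- **The padded context** `⟨q, 1^{|q|³}⟩`: the pad makes every piece the loops emit "linear in the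
first field", which is the growth discipline of `loopFn_mem_FP`. [folklore] -/
noncomputable def mkCtx : List Bool → List Bool := fanoutFn id (polyFn (X ^ 3))

/-- The context of the query matrix `M`. [folklore] -/
def ctxOf (M : Fin n → Fin n → ℤ) : List Bool := boolPair (qcode M) (ones (codeLen M ^ 3))

/-- `mkCtx` builds the context. [folklore] -/
theorem mkCtx_qcode (M : Fin n → Fin n → ℤ) : mkCtx (qcode M) = ctxOf M := by
  simp [mkCtx, ctxOf, length_qcode]

/-- `mkCtx ∈ FP`. [folklore] -/
theorem mkCtx_mem_FP : mkCtx ∈ FP := fanoutFn_mem_FP id_mem_FP (polyFn_mem_FP _)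

/-- The context is at least `|⟨M⟩|³` long and at least `|⟨M⟩|` long. [folklore] -/
theorem length_ctxOf (M : Fin n → Fin n → ℤ) : (ctxOf M).length = 2 * codeLen M + 2 + codeLen M ^ 3 := by
  rw [ctxOf, length_boolPair, length_qcode]; simp

/-- `4 ≤ |⟨M⟩|`. [folklore] -/
theorem four_le_codeLen (M : Fin n → Fin n → ℤ) : 4 ≤ codeLen M := by
  rw [← length_qcode, qcode_eq, length_boolPair, length_boolPair]; omega

/-- `|⟨M⟩| ≤ |ctx|`, `|⟨M⟩|² ≤ |ctx|`, `|⟨M⟩|³ ≤ |ctx|`. [folklore] -/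
theorem codeLen_pow_le_length_ctxOf (M : Fin n → Fin n → ℤ) :
    codeLen M ≤ (ctxOf M).length ∧ codeLen M ^ 2 ≤ (ctxOf M).length ∧ codeLen M ^ 3 ≤ (ctxOf M).length := by
  rw [length_ctxOf]
  have h4 := four_le_codeLen M
  refine ⟨by omega, ?_, by omega⟩
  calc codeLen M ^ 2 ≤ codeLen M ^ 3 := Nat.pow_le_pow_right (by omega) (by norm_num)
    _ ≤ _ := by omega

/-- `bin n` from the context. [folklore] -/
def encN : List Bool → List Bool := fstF ∘ fstF
/-- `1ⁿ` from the context. [folklore] -/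
def onesN : List Bool → List Bool := fstF ∘ sndF ∘ fstF
/-- The body of the row list from the context. [folklore] -/
def rowsB : List Bool → List Bool := sndF ∘ sndF ∘ fstF
/-- `1ᵗ`, `t = 3 |q|`, from the context. [folklore] -/
noncomputable def tU : List Bool → List Bool := polyFn (3 * X) ∘ fstF

/-- `encN ctx = bin n`. [folklore] -/
@[simp] theorem encN_ctxOf (M : Fin n → Fin n → ℤ) : encN (ctxOf M) = encodeNat n := by
  simp [encN, ctxOf, qcode_eq]
/-- `onesN ctx = 1ⁿ`. [folklore] -/
@[simp] theorem onesN_ctxOf (M : Fin n → Fin n → ℤ) : onesN (ctxOf M) = ones n := by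
  simp [onesN, ctxOf, qcode_eq]
/-- `rowsB ctx = body rows`. [folklore] -/
@[simp] theorem rowsB_ctxOf (M : Fin n → Fin n → ℤ) : rowsB (ctxOf M) = body (List.ofFn (rowOf M)) := by
  simp [rowsB, ctxOf, qcode_eq]
/-- `tU ctx = 1ᵗ`. [folklore] -/
@[simp] theorem tU_ctxOf (M : Fin n → Fin n → ℤ) : tU (ctxOf M) = ones (tOf M) := by
  simp [tU, ctxOf, tOf, length_qcode]

/-- The accessors are in `FP`. [folklore] -/
theorem accessors_mem_FP : encN ∈ FP ∧ onesN ∈ FP ∧ rowsB ∈ FP ∧ tU ∈ FP :=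
  ⟨comp_mem_FP fstF_mem_FP fstF_mem_FP, comp_mem_FP fstF_mem_FP (comp_mem_FP sndF_mem_FP fstF_mem_FP),
    comp_mem_FP sndF_mem_FP (comp_mem_FP sndF_mem_FP fstF_mem_FP), comp_mem_FP (polyFn_mem_FP _) fstF_mem_FP⟩

/-- `getD` on `List.ofFn` in range. [folklore] -/
theorem getD_ofFn {α : Type} {m : ℕ} (f : Fin m → α) (i : Fin m) (d : α) : (List.ofFn f).getD i d = f i := by
  rw [List.getD_eq_getElem?_getD, List.getElem?_ofFn, dif_pos i.isLt]; rfl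

/-- `1ⁱ = 1ʲ ↔ i = j`. [folklore] -/
@[simp] theorem replicate_true_inj {i j : ℕ} : List.replicate i true = List.replicate j true ↔ i = j :=
  ⟨fun h => by simpa using congrArg List.length h, fun h => h ▸ rfl⟩

/-- The equality test on unary strings. [folklore] -/
@[simp] theorem eqPairFn_ones (i j : ℕ) : eqPairFn (boolPair (ones i) (ones j)) = [decide (i = j)] := by
  rw [eqPairFn_boolPair]; simp

/-! ### Reading an entry: `entryF ⟨ctx, ⟨1ⁱ, 1ʲ⟩⟩ = intCode (M i j)` -/

/-- The entry reader: item `j` of the body of item `i` of the row list. [folklore] -/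
noncomputable def entryF : List Bool → List Bool :=
  nthItemFn ∘ fanoutFn (sndF ∘ sndF) (sndF ∘ nthItemFn ∘ fanoutFn (fstF ∘ sndF) (rowsB ∘ fstF))

/-- **`entryF` reads the entry code.** [folklore] -/
@[simp] theorem entryF_apply (M : Fin n → Fin n → ℤ) (i j : Fin n) :
    entryF (boolPair (ctxOf M) (boolPair (ones i) (ones j))) = intCode (M i j) := by
  simp only [entryF, Function.comp_apply, fanoutFn_apply, sndF_boolPair, fstF_boolPair, rowsB_ctxOf,
    nthItemFn_body, getD_ofFn, rowOf]

/-- `entryF ∈ FP`. [folklore] -/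
theorem entryF_mem_FP : entryF ∈ FP :=
  comp_mem_FP nthItemFn_mem_FP (fanoutFn_mem_FP (comp_mem_FP sndF_mem_FP sndF_mem_FP)
    (comp_mem_FP sndF_mem_FP (comp_mem_FP nthItemFn_mem_FP
      (fanoutFn_mem_FP (comp_mem_FP fstF_mem_FP sndF_mem_FP) (comp_mem_FP accessors_mem_FP.2.2.1 fstF_mem_FP)))))

/-! ### The Gram sums `P`, `Q` of a pair of columns (fold over the rows) -/

section Gram

/-- On `⟨w, 1ⁱ⟩` with `w = ⟨ctx, ⟨1ᵃ, 1ᵇ⟩⟩`: the entry `x_{ia}`. [folklore] -/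
noncomputable def EA : List Bool → List Bool :=
  entryF ∘ fanoutFn (fstF ∘ fstF) (fanoutFn sndF (fstF ∘ sndF ∘ fstF))
/-- On `⟨w, 1ⁱ⟩`: the entry `x_{ib}`. [folklore] -/
noncomputable def EB : List Bool → List Bool :=
  entryF ∘ fanoutFn (fstF ∘ fstF) (fanoutFn sndF (sndF ∘ sndF ∘ fstF))
/-- On `⟨w, 1ⁱ⟩`: the sign bits of `x_{ia}`, `x_{ib}` agree (one-bit). [folklore] -/
noncomputable def sameSignF : List Bool → List Bool := eqPairFn ∘ fanoutFn (fstF ∘ EA) (fstF ∘ EB)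
/-- On `⟨w, 1ⁱ⟩`: `bin (|x_{ia}| |x_{ib}|)`. [folklore] -/
noncomputable def prodABF : List Bool → List Bool := prodFn ∘ fanoutFn (sndF ∘ EA) (sndF ∘ EB)
/-- The summand of `P`: the product when the signs agree, else `0`. [folklore] -/
noncomputable def termPF : List Bool → List Bool := iteFn sameSignF prodABF (fun _ => [])
/-- The summand of `Q`: the product when the signs differ, else `0`. [folklore] -/
noncomputable def termQF : List Bool → List Bool := iteFn sameSignF (fun _ => []) prodABF

/-- The argument shape of the Gram loops. [folklore] -/
abbrev gw (M : Fin n → Fin n → ℤ) (a b : ℕ) : List Bool := boolPair (ctxOf M) (boolPair (ones a) (ones b))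

/-- `EA` reads `x_{ia}`. [folklore] -/
theorem EA_apply (M : Fin n → Fin n → ℤ) (a b i : Fin n) : EA (boolPair (gw M a b) (ones i)) = intCode (M i a) := by
  simp [EA, gw]
/-- `EB` reads `x_{ib}`. [folklore] -/
theorem EB_apply (M : Fin n → Fin n → ℤ) (a b i : Fin n) : EB (boolPair (gw M a b) (ones i)) = intCode (M i b) := by
  simp [EB, gw]

/-- `sameSignF` tests the sign bits. [folklore] -/
theorem sameSignF_apply (M : Fin n → Fin n → ℤ) (a b i : Fin n) :
    sameSignF (boolPair (gw M a b) (ones i)) = [decide (sameSign M i a b)] := by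
  simp only [sameSignF, Function.comp_apply, fanoutFn_apply, EA_apply, EB_apply, intCode_eq, fstF_boolPair,
    eqPairFn_boolPair, sameSign, xAt_eq, List.cons.injEq, and_true]

/-- `prodABF` multiplies the magnitudes. [folklore] -/
theorem prodABF_apply (M : Fin n → Fin n → ℤ) (a b i : Fin n) :
    prodABF (boolPair (gw M a b) (ones i)) = encodeNat ((M i a).natAbs * (M i b).natAbs) := by
  simp [prodABF, EA_apply, EB_apply, intCode_eq]

/-- Value of the `P`-summand. [folklore] -/
theorem termPF_apply (M : Fin n → Fin n → ℤ) (a b i : Fin n) :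
    termPF (boolPair (gw M a b) (ones i)) =
      encodeNat (if sameSign M i a b then (xAt M i a).natAbs * (xAt M i b).natAbs else 0) := by
  rw [termPF, iteFn_apply (sameSignF_apply M a b i)]
  by_cases h : sameSign M i a b
  · simp [h, prodABF_apply, xAt_eq]
  · simp [h]; rfl

/-- Value of the `Q`-summand. [folklore] -/
theorem termQF_apply (M : Fin n → Fin n → ℤ) (a b i : Fin n) :
    termQF (boolPair (gw M a b) (ones i)) =
      encodeNat (if sameSign M i a b then 0 else (xAt M i a).natAbs * (xAt M i b).natAbs) := by
  rw [termQF, iteFn_apply (sameSignF_apply M a b i)]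
  by_cases h : sameSign M i a b
  · simp [h]; rfl
  · simp [h, prodABF_apply, xAt_eq]

/-- The pieces are in `FP`. [folklore] -/
theorem termPF_mem_FP : termPF ∈ FP ∧ termQF ∈ FP := by
  have hEA : EA ∈ FP := comp_mem_FP entryF_mem_FP (fanoutFn_mem_FP (comp_mem_FP fstF_mem_FP fstF_mem_FP)
    (fanoutFn_mem_FP sndF_mem_FP (comp_mem_FP fstF_mem_FP (comp_mem_FP sndF_mem_FP fstF_mem_FP))))
  have hEB : EB ∈ FP := comp_mem_FP entryF_mem_FP (fanoutFn_mem_FP (comp_mem_FP fstF_mem_FP fstF_mem_FP)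
    (fanoutFn_mem_FP sndF_mem_FP (comp_mem_FP sndF_mem_FP (comp_mem_FP sndF_mem_FP fstF_mem_FP))))
  have hs : sameSignF ∈ FP :=
    comp_mem_FP eqPairFn_mem_FP (fanoutFn_mem_FP (comp_mem_FP fstF_mem_FP hEA) (comp_mem_FP fstF_mem_FP hEB))
  have hp : prodABF ∈ FP :=
    comp_mem_FP prodFn_mem_FP (fanoutFn_mem_FP (comp_mem_FP sndF_mem_FP hEA) (comp_mem_FP sndF_mem_FP hEB))
  exact ⟨iteFn_mem_FP hs hp (const_mem_FP _), iteFn_mem_FP hs (const_mem_FP _) hp⟩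

/-- **The summands are short**: at most `2 |⟨M⟩|` symbols (two magnitudes). [folklore] -/
theorem length_termPF_le (M : Fin n → Fin n → ℤ) (a b i : Fin n) :
    (termPF (boolPair (gw M a b) (ones i))).length ≤ 2 * codeLen M ∧
      (termQF (boolPair (gw M a b) (ones i))).length ≤ 2 * codeLen M := by
  have hmul : (encodeNat ((xAt M i a).natAbs * (xAt M i b).natAbs)).length ≤ 2 * codeLen M := by
    rw [xAt_eq, xAt_eq]
    have h := length_encodeNat_mul_le (encodeNat (M i a).natAbs) (encodeNat (M i b).natAbs)
    rw [bitsToNat_encodeNat, bitsToNat_encodeNat] at h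
    have h1 := length_encodeNat_entry_le M i a
    have h2 := length_encodeNat_entry_le M i b
    omega
  rw [termPF_apply, termQF_apply]
  constructor <;> split_ifs <;> first | exact hmul | exact Nat.zero_le _

/-- The initial record of the Gram loops: `⟨w, ⟨bin n, ⟨1⁰, bin 0⟩⟩⟩`. [folklore] -/
noncomputable def initG : List Bool → List Bool := fanoutFn id (fanoutFn (encN ∘ fstF) (fun _ => boolPair [] []))

/-- **`P` as a string function**: fold the `P`-summands over the rows. [folklore] -/
noncomputable def gramPF : List Bool → List Bool := sndPow 2 ∘ foldLoop addFn (clipF 2 termPF) X ∘ initG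
/-- **`Q` as a string function**. [folklore] -/
noncomputable def gramQF : List Bool → List Bool := sndPow 2 ∘ foldLoop addFn (clipF 2 termQF) X ∘ initG

/-- `|w| ≥ n`: enough rounds for the Gram loops. [folklore] -/
theorem n_le_length_gw (M : Fin n → Fin n → ℤ) (a b : ℕ) : n ≤ (gw M a b).length := by
  rw [gw, length_boolPair]
  have h1 := (codeLen_pow_le_length_ctxOf M).1
  have h2 := le_codeLen M
  omega

/-- `|⟨M⟩| ≤ |w|`. [folklore] -/
theorem codeLen_le_length_gw (M : Fin n → Fin n → ℤ) (a b : ℕ) : codeLen M ≤ (gw M a b).length := by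
  rw [gw, length_boolPair]
  have h1 := (codeLen_pow_le_length_ctxOf M).1
  omega

/-- A sum over `range n` of a function of `Fin n`-indices. [folklore] -/
theorem sum_range_eq_of_fin {β : Type} [AddCommMonoid β] (f g : ℕ → β)
    (h : ∀ i : Fin n, f i = g i) : ∑ j ∈ range n, f j = ∑ j ∈ range n, g j :=
  Finset.sum_congr rfl fun j hj => h ⟨j, Finset.mem_range.1 hj⟩

/-- **`gramPF` computes `bin P`.** [folklore] -/
@[simp] theorem gramPF_apply (M : Fin n → Fin n → ℤ) (a b : Fin n) : gramPF (gw M a b) = encodeNat (gramP M a b) := by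
  have hinit : initG (gw M a b) = boolPair (gw M a b) (boolPair (encodeNat n) (boolPair (ones 0) (encodeNat 0))) := by
    simp [initG, gw]; rfl
  have hk : n ≤ X.eval (gw M a b).length := by simpa using n_le_length_gw M a b
  rw [gramPF, Function.comp_apply, Function.comp_apply, hinit, foldLoop_apply _ _ hk, sndPow_succ_boolPair,
    sndPow_succ_boolPair, sndPow_zero_boolPair, foldAcc_clipF, foldAcc_addFn, Nat.zero_add, gramP]
  · apply congrArg encodeNat
    exact sum_range_eq_of_fin _ _ fun i => by rw [Nat.zero_add, termPF_apply, bitsToNat_encodeNat]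
  · intro j _ hj
    rw [Nat.zero_add] at hj
    have h := (length_termPF_le M a b ⟨j, hj⟩).1
    have hc := codeLen_le_length_gw M a b
    simp only at h
    omega

/-- **`gramQF` computes `bin Q`.** [folklore] -/
@[simp] theorem gramQF_apply (M : Fin n → Fin n → ℤ) (a b : Fin n) : gramQF (gw M a b) = encodeNat (gramQ M a b) := by
  have hinit : initG (gw M a b) = boolPair (gw M a b) (boolPair (encodeNat n) (boolPair (ones 0) (encodeNat 0))) := by
    simp [initG, gw]; rfl
  have hk : n ≤ X.eval (gw M a b).length := by simpa using n_le_length_gw M a b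
  rw [gramQF, Function.comp_apply, Function.comp_apply, hinit, foldLoop_apply _ _ hk, sndPow_succ_boolPair,
    sndPow_succ_boolPair, sndPow_zero_boolPair, foldAcc_clipF, foldAcc_addFn, Nat.zero_add, gramQ]
  · apply congrArg encodeNat
    exact sum_range_eq_of_fin _ _ fun i => by rw [Nat.zero_add, termQF_apply, bitsToNat_encodeNat]
  · intro j _ hj
    rw [Nat.zero_add] at hj
    have h := (length_termPF_le M a b ⟨j, hj⟩).2
    have hc := codeLen_le_length_gw M a b
    simp only at h
    omega

/-- `gramPF, gramQF ∈ FP`. [folklore] -/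
theorem gramPF_mem_FP : gramPF ∈ FP ∧ gramQF ∈ FP := by
  have hi : initG ∈ FP := fanoutFn_mem_FP id_mem_FP (fanoutFn_mem_FP (comp_mem_FP accessors_mem_FP.1 fstF_mem_FP) (const_mem_FP _))
  exact ⟨comp_mem_FP (sndPow_mem_FP 2) (comp_mem_FP (foldLoop_clipF_mem_FP 2 addFn_mem_FP length_addFn_le termPF_mem_FP.1 X) hi),
    comp_mem_FP (sndPow_mem_FP 2) (comp_mem_FP (foldLoop_clipF_mem_FP 2 addFn_mem_FP length_addFn_le termPF_mem_FP.2 X) hi)⟩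

/-! ### The signed Gram entry, its magnitude and square -/

/-- **The integer code of `⟨x_a, x_b⟩ = P - Q`**: sign `[P < Q]`, magnitude `(P ∸ Q) + (Q ∸ P)`. [folklore] -/
noncomputable def gramZF : List Bool → List Bool :=
  fanoutFn (ltFn ∘ fanoutFn gramPF gramQF)
    (addFn ∘ fanoutFn (subFn ∘ fanoutFn gramPF gramQF) (subFn ∘ fanoutFn gramQF gramPF))

/-- **`gramZF` computes `intCode ⟨x_a, x_b⟩`.** [folklore] -/
@[simp] theorem gramZF_apply (M : Fin n → Fin n → ℤ) (a b : Fin n) :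
    gramZF (gw M a b) = intCode (colGram (Matrix.of M) a b) := by
  rw [← gramAt_eq, gramAt_eq_sub, intCode_sub]
  simp [gramZF]

/-- The magnitude `bin |⟨x_a, x_b⟩|`. [folklore] -/
noncomputable def gramMagF : List Bool → List Bool := sndF ∘ gramZF

/-- Value of `gramMagF`. [folklore] -/
@[simp] theorem gramMagF_apply (M : Fin n → Fin n → ℤ) (a b : Fin n) :
    gramMagF (gw M a b) = encodeNat (colGram (Matrix.of M) a b).natAbs := by
  simp [gramMagF, intCode_eq]

/-- The square `bin ⟨x_a, x_b⟩²`. [folklore] -/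
noncomputable def gramSqF : List Bool → List Bool := prodFn ∘ fanoutFn gramMagF gramMagF

/-- Value of `gramSqF`. [folklore] -/
@[simp] theorem gramSqF_apply (M : Fin n → Fin n → ℤ) (a b : Fin n) :
    gramSqF (gw M a b) = encodeNat ((colGram (Matrix.of M) a b).natAbs ^ 2) := by
  simp [gramSqF, sq]

/-- `gramZF, gramMagF, gramSqF ∈ FP`. [folklore] -/
theorem gramZF_mem_FP : gramZF ∈ FP ∧ gramMagF ∈ FP ∧ gramSqF ∈ FP := by
  have hPQ : fanoutFn gramPF gramQF ∈ FP := fanoutFn_mem_FP gramPF_mem_FP.1 gramPF_mem_FP.2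
  have hQP : fanoutFn gramQF gramPF ∈ FP := fanoutFn_mem_FP gramPF_mem_FP.2 gramPF_mem_FP.1
  have hZ : gramZF ∈ FP := fanoutFn_mem_FP (comp_mem_FP ltFn_mem_FP hPQ)
    (comp_mem_FP addFn_mem_FP (fanoutFn_mem_FP (comp_mem_FP subFn_mem_FP hPQ) (comp_mem_FP subFn_mem_FP hQP)))
  have hM : gramMagF ∈ FP := comp_mem_FP sndF_mem_FP hZ
  exact ⟨hZ, hM, comp_mem_FP prodFn_mem_FP (fanoutFn_mem_FP hM hM)⟩

/-- **Sizes of Gram magnitudes**: `|bin |⟨x_a,x_b⟩|| ≤ 3 |⟨M⟩|` and `|bin ⟨x_a,x_b⟩²| ≤ 6 |⟨M⟩|`. [folklore] -/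
theorem length_gramMag_le (M : Fin n → Fin n → ℤ) (a b : Fin n) :
    (encodeNat (colGram (Matrix.of M) a b).natAbs).length ≤ 3 * codeLen M ∧
      (encodeNat ((colGram (Matrix.of M) a b).natAbs ^ 2)).length ≤ 6 * codeLen M := by
  set L := codeLen M
  have hn : n < 2 ^ L := (le_codeLen M).trans_lt (Nat.lt_two_pow_self)
  have hg : (colGram (Matrix.of M) a b).natAbs ≤ n * 4 ^ L := by
    have h := abs_colGram_le M a b
    rw [← Int.natCast_natAbs] at h
    exact_mod_cast h
  have hlt : (colGram (Matrix.of M) a b).natAbs < 2 ^ (3 * L) := by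
    calc (colGram (Matrix.of M) a b).natAbs ≤ n * 4 ^ L := hg
      _ < 2 ^ L * 4 ^ L := Nat.mul_lt_mul_of_lt_of_le hn le_rfl (by positivity)
      _ = 2 ^ (3 * L) := by rw [show (4 : ℕ) = 2 ^ 2 by norm_num, ← pow_mul, ← pow_add]; ring_nf
  constructor
  · rw [TM2Pass.length_encodeNat_eq_size, Nat.size_le]; exact hlt
  · rw [TM2Pass.length_encodeNat_eq_size, Nat.size_le]
    calc (colGram (Matrix.of M) a b).natAbs ^ 2 < (2 ^ (3 * L)) ^ 2 := Nat.pow_lt_pow_left hlt (by norm_num)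
      _ = 2 ^ (6 * L) := by rw [← pow_mul]; ring_nf

end Gram


/-! ### The diagonal Gram entry after the pair rows: `pairDiagF ⟨ctx, 1ᵃ⟩ = bin (pairDiagN a)` -/

section PairDiag

/-- The argument shape `⟨ctx, 1ᵃ⟩`. [folklore] -/
abbrev gv (M : Fin n → Fin n → ℤ) (a : ℕ) : List Bool := boolPair (ctxOf M) (ones a)

/-- On `⟨v, 1ᵏ⟩` with `v = ⟨ctx, 1ᵃ⟩`: the Gram argument `⟨ctx, ⟨1ᵃ, 1ᵏ⟩⟩`. [folklore] -/
noncomputable def AKF : List Bool → List Bool := fanoutFn (fstF ∘ fstF) (fanoutFn (sndF ∘ fstF) sndF)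
/-- On `⟨v, 1ᵏ⟩`: `[a < k]`. [folklore] -/
noncomputable def aLTk : List Bool → List Bool := ltLenF ∘ fanoutFn (sndF ∘ fstF) sndF
/-- On `⟨v, 1ᵏ⟩`: `[k < a]`. [folklore] -/
noncomputable def kLTa : List Bool → List Bool := ltLenF ∘ fanoutFn sndF (sndF ∘ fstF)
/-- The summand of the diagonal entry: `⟨x_a,x_k⟩²` for `a < k`, `1` for `k < a`, `0` for `k = a`. [folklore] -/
noncomputable def termDF : List Bool → List Bool :=
  iteFn aLTk (gramSqF ∘ AKF) (iteFn kLTa (fun _ => [true]) (fun _ => []))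

/-- `AKF` rearranges the fields. [folklore] -/
theorem AKF_apply (M : Fin n → Fin n → ℤ) (a k : ℕ) : AKF (boolPair (gv M a) (ones k)) = gw M a k := by
  simp [AKF]

/-- Value of the diagonal summand. [folklore] -/
theorem termDF_apply (M : Fin n → Fin n → ℤ) (a k : Fin n) :
    termDF (boolPair (gv M a) (ones k)) =
      encodeNat (if (a : ℕ) < k then (gramAt M a k).natAbs ^ 2 else if (k : ℕ) < a then 1 else 0) := by
  have h1 : aLTk (boolPair (gv M a) (ones k)) = [decide ((a : ℕ) < k)] := by simp [aLTk]
  have h2 : kLTa (boolPair (gv M a) (ones k)) = [decide ((k : ℕ) < a)] := by simp [kLTa]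
  rw [termDF, iteFn_apply h1]
  by_cases hak : (a : ℕ) < k
  · simp [hak, AKF_apply, gramAt_eq]
  · rw [if_neg (by simpa using hak), iteFn_apply h2, if_neg hak]
    by_cases hka : (k : ℕ) < a
    · simp [hka]; rfl
    · simp [hka]; rfl

/-- `termDF ∈ FP`. [folklore] -/
theorem termDF_mem_FP : termDF ∈ FP :=
  iteFn_mem_FP (comp_mem_FP ltLenF_mem_FP (fanoutFn_mem_FP (comp_mem_FP sndF_mem_FP fstF_mem_FP) sndF_mem_FP))
    (comp_mem_FP gramZF_mem_FP.2.2 (fanoutFn_mem_FP (comp_mem_FP fstF_mem_FP fstF_mem_FP)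
      (fanoutFn_mem_FP (comp_mem_FP sndF_mem_FP fstF_mem_FP) sndF_mem_FP)))
    (iteFn_mem_FP (comp_mem_FP ltLenF_mem_FP (fanoutFn_mem_FP sndF_mem_FP (comp_mem_FP sndF_mem_FP fstF_mem_FP)))
      (const_mem_FP _) (const_mem_FP _))

/-- The diagonal summands are short: at most `6 |⟨M⟩|` symbols. [folklore] -/
theorem length_termDF_le (M : Fin n → Fin n → ℤ) (a k : Fin n) :
    (termDF (boolPair (gv M a) (ones k))).length ≤ 6 * codeLen M := by
  rw [termDF_apply]
  have h4 := four_le_codeLen M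
  split_ifs
  · rw [gramAt_eq]; exact (length_gramMag_le M a k).2
  · change [true].length ≤ _; simp; omega
  · exact Nat.zero_le _

/-- The argument `⟨ctx, ⟨1ᵃ, 1ᵃ⟩⟩` from `v`. [folklore] -/
noncomputable def AAF : List Bool → List Bool := fanoutFn fstF (fanoutFn sndF sndF)

/-- The initial record of the diagonal loop: `⟨v, ⟨bin n, ⟨1⁰, bin |⟨x_a,x_a⟩|⟩⟩⟩`. [folklore] -/
noncomputable def initD : List Bool → List Bool :=
  fanoutFn id (fanoutFn (encN ∘ fstF) (fanoutFn (fun _ => []) (gramMagF ∘ AAF)))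

/-- **The diagonal Gram entry as a string function.** [folklore] -/
noncomputable def pairDiagF : List Bool → List Bool := sndPow 2 ∘ foldLoop addFn (clipF 6 termDF) X ∘ initD

/-- `|v| ≥ n` and `|v| ≥ |⟨M⟩|`. [folklore] -/
theorem le_length_gv (M : Fin n → Fin n → ℤ) (a : ℕ) : n ≤ (gv M a).length ∧ codeLen M ≤ (gv M a).length := by
  rw [gv, length_boolPair]
  have h1 := (codeLen_pow_le_length_ctxOf M).1
  have h2 := le_codeLen M
  constructor <;> omega

/-- **`pairDiagF` computes `bin (pairDiagN a)`.** [folklore] -/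
@[simp] theorem pairDiagF_apply (M : Fin n → Fin n → ℤ) (a : Fin n) : pairDiagF (gv M a) = encodeNat (pairDiagN M a) := by
  have hinit : initD (gv M a) = boolPair (gv M a) (boolPair (encodeNat n) (boolPair (ones 0)
      (encodeNat (gramAt M a a).natAbs))) := by
    simp [initD, AAF, ← gramAt_eq]
  have hk : n ≤ X.eval (gv M a).length := by simpa using (le_length_gv M a).1
  rw [pairDiagF, Function.comp_apply, Function.comp_apply, hinit, foldLoop_apply _ _ hk, sndPow_succ_boolPair,
    sndPow_succ_boolPair, sndPow_zero_boolPair, foldAcc_clipF, foldAcc_addFn, pairDiagN]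
  · apply congrArg encodeNat
    apply congrArg (HAdd.hAdd _)
    exact sum_range_eq_of_fin _ _ fun k => by rw [Nat.zero_add, termDF_apply, bitsToNat_encodeNat]
  · intro j _ hj
    rw [Nat.zero_add] at hj
    have h := length_termDF_le M a ⟨j, hj⟩
    have hc := (le_length_gv M a).2
    simp only at h
    omega

/-- `pairDiagF ∈ FP`. [folklore] -/
theorem pairDiagF_mem_FP : pairDiagF ∈ FP :=
  comp_mem_FP (sndPow_mem_FP 2) (comp_mem_FP (foldLoop_clipF_mem_FP 6 addFn_mem_FP length_addFn_le termDF_mem_FP X)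
    (fanoutFn_mem_FP id_mem_FP (fanoutFn_mem_FP (comp_mem_FP accessors_mem_FP.1 fstF_mem_FP)
      (fanoutFn_mem_FP (const_mem_FP _) (comp_mem_FP gramZF_mem_FP.2.1
        (fanoutFn_mem_FP fstF_mem_FP (fanoutFn_mem_FP sndF_mem_FP sndF_mem_FP)))))))

/-! ### The deficit `4ᵗ - pairDiag` and the base-4 digit test -/

/-- On the context: `bin 4ᵗ = 0^{6|q|} 1`. [folklore] -/
noncomputable def pow4tF : List Bool → List Bool :=
  appF ∘ fanoutFn (Kannan.zerosFn ∘ polyFn (6 * X) ∘ fstF) (fun _ => [true])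

/-- `bin 4ᵗ`. [folklore] -/
theorem pow4tF_apply (M : Fin n → Fin n → ℤ) : pow4tF (ctxOf M) = encodeNat (4 ^ tOf M) := by
  rw [show (4 : ℕ) ^ tOf M = 2 ^ (6 * codeLen M) by rw [tOf, show (4 : ℕ) = 2 ^ 2 by norm_num, ← pow_mul]; ring_nf,
    Com.encodeNat_two_pow]
  simp [pow4tF, ctxOf, length_qcode]

/-- **The deficit `bin (4ᵗ - pairDiagN a)`** on `v = ⟨ctx, 1ᵃ⟩`. [folklore] -/
noncomputable def defF : List Bool → List Bool := subFn ∘ fanoutFn (pow4tF ∘ fstF) pairDiagF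

/-- Value of `defF`. [folklore] -/
@[simp] theorem defF_apply (M : Fin n → Fin n → ℤ) (a : Fin n) : defF (gv M a) = encodeNat (deficitN M (tOf M) a) := by
  rw [defF, Function.comp_apply, fanoutFn_apply, Function.comp_apply, show fstF (gv M a) = ctxOf M by simp,
    pow4tF_apply, pairDiagF_apply, subFn_boolPair, bitsToNat_encodeNat, bitsToNat_encodeNat, deficitN]

/-- `defF ∈ FP`. [folklore] -/
theorem defF_mem_FP : defF ∈ FP :=
  comp_mem_FP subFn_mem_FP (fanoutFn_mem_FP (comp_mem_FP (comp_mem_FP appF_mem_FP (fanoutFn_mem_FP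
    (comp_mem_FP Kannan.zerosFn_mem_FP (comp_mem_FP (polyFn_mem_FP _) fstF_mem_FP)) (const_mem_FP _))) fstF_mem_FP)
    pairDiagF_mem_FP)

/-- The argument shape `⟨⟨⟨ctx, 1ᵃ⟩, 1^{lvl}⟩, 1ˡ⟩` of the digit test (the context of a private row). [folklore] -/
abbrev gr (M : Fin n → Fin n → ℤ) (a lvl l : ℕ) : List Bool := boolPair (boolPair (gv M a) (ones lvl)) (ones l)

/-- On `r`: `bin 4^{lvl} = 0^{2 lvl} 1`. [folklore] -/
noncomputable def pow4lvlF : List Bool → List Bool :=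
  appF ∘ fanoutFn (Kannan.zerosFn ∘ appF ∘ fanoutFn (sndF ∘ fstF) (sndF ∘ fstF)) (fun _ => [true])

/-- On `r`: the `lvl`-th base-`4` digit of the deficit of column `a`, `bin (d / 4^{lvl} % 4)`. [folklore] -/
noncomputable def digitF : List Bool → List Bool :=
  remFn ∘ fanoutFn (divFn ∘ fanoutFn (defF ∘ fstF ∘ fstF) pow4lvlF) (fun _ => [false, false, true])

/-- **The digit test** `[l < digit]` on `r` (one-bit). [folklore] -/
noncomputable def digitBitF : List Bool → List Bool := ltFn ∘ fanoutFn (lenBinF ∘ sndF) digitF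

/-- Value of the digit test. [folklore] -/
@[simp] theorem digitBitF_apply (M : Fin n → Fin n → ℤ) (a : Fin n) (lvl l : ℕ) :
    digitBitF (gr M a lvl l) = [decide (l < base4Digit (deficitN M (tOf M) a) lvl)] := by
  have h4 : pow4lvlF (gr M a lvl l) = encodeNat (4 ^ lvl) := by
    rw [show (4 : ℕ) ^ lvl = 2 ^ (lvl + lvl) by rw [show (4 : ℕ) = 2 ^ 2 by norm_num, ← pow_mul]; ring_nf,
      Com.encodeNat_two_pow]
    simp [pow4lvlF]
  have hd : digitF (gr M a lvl l) = encodeNat (base4Digit (deficitN M (tOf M) a) lvl) := by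
    have hdef : (defF ∘ fstF ∘ fstF) (gr M a lvl l) = encodeNat (deficitN M (tOf M) a) := by simp
    have h3 : bitsToNat [false, false, true] = 4 := by decide
    rw [digitF, Function.comp_apply, fanoutFn_apply, Function.comp_apply, fanoutFn_apply, hdef, h4, divFn_boolPair,
      remFn_boolPair, bitsToNat_encodeNat, bitsToNat_encodeNat, bitsToNat_encodeNat, h3, base4Digit]
  rw [digitBitF, Function.comp_apply, fanoutFn_apply, Function.comp_apply, hd, lenBinF_apply, ltFn_boolPair,
    bitsToNat_encodeNat, bitsToNat_encodeNat]
  simp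

/-- `digitBitF ∈ FP`. [folklore] -/
theorem digitBitF_mem_FP : digitBitF ∈ FP :=
  comp_mem_FP ltFn_mem_FP (fanoutFn_mem_FP (comp_mem_FP lenBinF_mem_FP sndF_mem_FP)
    (comp_mem_FP remFn_mem_FP (fanoutFn_mem_FP (comp_mem_FP divFn_mem_FP (fanoutFn_mem_FP
      (comp_mem_FP defF_mem_FP (comp_mem_FP fstF_mem_FP fstF_mem_FP))
      (comp_mem_FP appF_mem_FP (fanoutFn_mem_FP (comp_mem_FP Kannan.zerosFn_mem_FP (comp_mem_FP appF_mem_FP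
        (fanoutFn_mem_FP (comp_mem_FP sndF_mem_FP fstF_mem_FP) (comp_mem_FP sndF_mem_FP fstF_mem_FP)))) (const_mem_FP _)))))
      (const_mem_FP _))))

/-- The digit test is one-bit. [folklore] -/
theorem oneBit_digitBitF : OneBit digitBitF := oneBit_ltFn.comp _

end PairDiag

/-! ### The three kinds of cells -/

section Cells

/-- Cells of the block `X`, on `⟨⟨ctx, 1ⁱ⟩, 1ʲ⟩`: the entry code paired with `intCode 0`. [folklore] -/
noncomputable def cellXF : List Bool → List Bool :=
  fanoutFn (entryF ∘ fanoutFn (fstF ∘ fstF) (fanoutFn (sndF ∘ fstF) sndF)) (fun _ => intCode 0)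

/-- **Value of an `X`-cell.** [folklore] -/
@[simp] theorem cellXF_apply (M : Fin n → Fin n → ℤ) (i j : Fin n) :
    cellXF (boolPair (gv M i) (ones j)) = cellCode (cellXv M i j) := by
  simp [cellXF, cellCode, cellXv, xAt_eq]

/-- `cellXF ∈ FP`. [folklore] -/
theorem cellXF_mem_FP : cellXF ∈ FP :=
  fanoutFn_mem_FP (comp_mem_FP entryF_mem_FP (fanoutFn_mem_FP (comp_mem_FP fstF_mem_FP fstF_mem_FP)
    (fanoutFn_mem_FP (comp_mem_FP sndF_mem_FP fstF_mem_FP) sndF_mem_FP))) (const_mem_FP _)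

/-- Cells of the pair rows, on `c = ⟨⟨⟨ctx, 1ᵃ⟩, 1ᵇ⟩, 1ʲ⟩`: for `a < b`, `intCode ⟨x_a,x_b⟩` in column `a`,
`intCode (-1)` in column `b`, zero elsewhere. [folklore] -/
noncomputable def cellPF : List Bool → List Bool :=
  iteFn (ltLenF ∘ fanoutFn (sndF ∘ fstF ∘ fstF) (sndF ∘ fstF))
    (iteFn (eqPairFn ∘ fanoutFn sndF (sndF ∘ fstF ∘ fstF))
      (fanoutFn (gramZF ∘ fanoutFn (fstF ∘ fstF ∘ fstF) (fanoutFn (sndF ∘ fstF ∘ fstF) (sndF ∘ fstF)))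
        (fun _ => intCode 0))
      (iteFn (eqPairFn ∘ fanoutFn sndF (sndF ∘ fstF)) (fun _ => cellCode (-1)) (fun _ => cellCode 0)))
    (fun _ => cellCode 0)

/-- The argument shape `⟨⟨ctx, 1ᵃ⟩, 1ᵇ⟩` (context of a pair row). [folklore] -/
abbrev gvb (M : Fin n → Fin n → ℤ) (a b : ℕ) : List Bool := boolPair (gv M a) (ones b)

/-- **Value of a pair cell.** [folklore] -/
@[simp] theorem cellPF_apply (M : Fin n → Fin n → ℤ) (a b j : Fin n) :
    cellPF (boolPair (gvb M a b) (ones j)) = cellCode (cellPv M a b j) := by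
  have h1 : (ltLenF ∘ fanoutFn (sndF ∘ fstF ∘ fstF) (sndF ∘ fstF)) (boolPair (gvb M a b) (ones j)) =
      [decide ((a : ℕ) < b)] := by simp
  have h2 : (eqPairFn ∘ fanoutFn sndF (sndF ∘ fstF ∘ fstF)) (boolPair (gvb M a b) (ones j)) =
      [decide ((j : ℕ) = a)] := by simp
  have h3 : (eqPairFn ∘ fanoutFn sndF (sndF ∘ fstF)) (boolPair (gvb M a b) (ones j)) = [decide ((j : ℕ) = b)] := by
    simp
  have hz : (gramZF ∘ fanoutFn (fstF ∘ fstF ∘ fstF) (fanoutFn (sndF ∘ fstF ∘ fstF) (sndF ∘ fstF)))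
      (boolPair (gvb M a b) (ones j)) = intCode (gramAt M a b) := by
    simp [← gramAt_eq]
  rw [cellPF, iteFn_apply h1]
  unfold cellPv
  by_cases hab : (a : ℕ) < b
  · rw [if_pos (decide_eq_true hab), if_pos hab, iteFn_apply h2]
    by_cases hja : (j : ℕ) = a
    · rw [if_pos (decide_eq_true hja), if_pos hja, fanoutFn_apply, hz]; rfl
    · rw [if_neg (by simpa using hja), if_neg hja, iteFn_apply h3]
      by_cases hjb : (j : ℕ) = b
      · rw [if_pos (decide_eq_true hjb), if_pos hjb]
      · rw [if_neg (by simpa using hjb), if_neg hjb]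
  · rw [if_neg (by simpa using hab), if_neg hab]

/-- `cellPF ∈ FP`. [folklore] -/
theorem cellPF_mem_FP : cellPF ∈ FP :=
  iteFn_mem_FP (comp_mem_FP ltLenF_mem_FP (fanoutFn_mem_FP (comp_mem_FP sndF_mem_FP (comp_mem_FP fstF_mem_FP fstF_mem_FP))
      (comp_mem_FP sndF_mem_FP fstF_mem_FP)))
    (iteFn_mem_FP (comp_mem_FP eqPairFn_mem_FP (fanoutFn_mem_FP sndF_mem_FP
        (comp_mem_FP sndF_mem_FP (comp_mem_FP fstF_mem_FP fstF_mem_FP))))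
      (fanoutFn_mem_FP (comp_mem_FP gramZF_mem_FP.1 (fanoutFn_mem_FP (comp_mem_FP fstF_mem_FP
        (comp_mem_FP fstF_mem_FP fstF_mem_FP)) (fanoutFn_mem_FP (comp_mem_FP sndF_mem_FP
          (comp_mem_FP fstF_mem_FP fstF_mem_FP)) (comp_mem_FP sndF_mem_FP fstF_mem_FP)))) (const_mem_FP _))
      (iteFn_mem_FP (comp_mem_FP eqPairFn_mem_FP (fanoutFn_mem_FP sndF_mem_FP (comp_mem_FP sndF_mem_FP fstF_mem_FP)))
        (const_mem_FP _) (const_mem_FP _)))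
    (const_mem_FP _)

/-- On `⟨r, 1ʲ⟩`: `bin 2^{lvl} = 0^{lvl} 1`. [folklore] -/
noncomputable def pow2lvlF : List Bool → List Bool :=
  appF ∘ fanoutFn (Kannan.zerosFn ∘ sndF ∘ fstF ∘ fstF) (fun _ => [true])

/-- Cells of the private rows, on `⟨r, 1ʲ⟩` with `r = ⟨⟨⟨ctx, 1ᵃ⟩, 1^{lvl}⟩, 1ˡ⟩`: `intCode 2^{lvl}` in
column `a` when the digit test passes, zero elsewhere. [folklore] -/
noncomputable def cellVF : List Bool → List Bool :=
  iteFn (andFn (eqPairFn ∘ fanoutFn sndF (sndF ∘ fstF ∘ fstF ∘ fstF)) (digitBitF ∘ fstF))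
    (fanoutFn (fanoutFn (fun _ => [false]) pow2lvlF) (fun _ => intCode 0)) (fun _ => cellCode 0)

/-- **Value of a private cell.** [folklore] -/
@[simp] theorem cellVF_apply (M : Fin n → Fin n → ℤ) (a j : Fin n) (lvl l : ℕ) :
    cellVF (boolPair (gr M a lvl l) (ones j)) = cellCode (cellVv M (tOf M) a lvl l j) := by
  have h1 : (eqPairFn ∘ fanoutFn sndF (sndF ∘ fstF ∘ fstF ∘ fstF)) (boolPair (gr M a lvl l) (ones j)) =
      [decide ((j : ℕ) = a)] := by simp
  have h2 : (digitBitF ∘ fstF) (boolPair (gr M a lvl l) (ones j)) =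
      [decide (l < base4Digit (deficitN M (tOf M) a) lvl)] := by simp
  have hc := andFn_apply h1 h2
  rw [cellVF, iteFn_apply hc]
  unfold cellVv
  by_cases h : (j : ℕ) = a ∧ l < base4Digit (deficitN M (tOf M) a) lvl
  · obtain ⟨hja, hl⟩ := h
    rw [if_pos (by simp [hja, hl]), if_pos ⟨hja, hl⟩, cellCode, intCode_eq ((2 : ℤ) ^ lvl)]
    have e1 : decide ((2 : ℤ) ^ lvl < 0) = false := decide_eq_false (not_lt.2 (by positivity))
    have e2 : ((2 : ℤ) ^ lvl).natAbs = 2 ^ lvl := by rw [Int.natAbs_pow]; rfl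
    rw [e1, e2, Com.encodeNat_two_pow]
    simp [pow2lvlF]
  · rw [if_neg (by simpa [Bool.and_eq_true, decide_eq_true_eq, not_and] using (not_and.1 h)), if_neg h]

/-- `cellVF ∈ FP`. [folklore] -/
theorem cellVF_mem_FP : cellVF ∈ FP :=
  iteFn_mem_FP (andFn_mem_FP (comp_mem_FP eqPairFn_mem_FP (fanoutFn_mem_FP sndF_mem_FP
      (comp_mem_FP sndF_mem_FP (comp_mem_FP fstF_mem_FP (comp_mem_FP fstF_mem_FP fstF_mem_FP)))))
      (comp_mem_FP digitBitF_mem_FP fstF_mem_FP))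
    (fanoutFn_mem_FP (fanoutFn_mem_FP (const_mem_FP _) (comp_mem_FP appF_mem_FP (fanoutFn_mem_FP
      (comp_mem_FP Kannan.zerosFn_mem_FP (comp_mem_FP sndF_mem_FP (comp_mem_FP fstF_mem_FP fstF_mem_FP))) (const_mem_FP _))))
      (const_mem_FP _))
    (const_mem_FP _)

/-- **Cell magnitudes are short**: every cell written by the machine is `cellCode z` with
`|bin |z|| ≤ 3 |⟨M⟩| + 1`. [folklore] -/
theorem length_cell_le (M : Fin n → Fin n → ℤ) :
    (∀ i j : Fin n, (encodeNat (cellXv M i j).natAbs).length ≤ 3 * codeLen M + 1) ∧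
    (∀ a b j : Fin n, (encodeNat (cellPv M a b j).natAbs).length ≤ 3 * codeLen M + 1) ∧
    (∀ (a j : Fin n) (lvl l : ℕ), lvl ≤ tOf M → (encodeNat (cellVv M (tOf M) a lvl l j).natAbs).length ≤ 3 * codeLen M + 1) := by
  refine ⟨fun i j => ?_, fun a b j => ?_, fun a j lvl l hl => ?_⟩
  · rw [cellXv, xAt_eq]
    have := length_encodeNat_entry_le M i j; omega
  · unfold cellPv
    split_ifs
    · rw [gramAt_eq]; have := (length_gramMag_le M a b).1; omega
    · exact le_trans (by decide : (encodeNat (-1 : ℤ).natAbs).length ≤ 1) (by omega)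
    · exact Nat.zero_le _
    · exact Nat.zero_le _
  · unfold cellVv
    split_ifs
    · rw [Int.natAbs_pow, show (2 : ℤ).natAbs = 2 from rfl, Com.encodeNat_two_pow]
      simp [tOf] at hl ⊢; omega
    · exact Nat.zero_le _

end Cells


/-! ### Concatenation folds: `cmapF cnt piece C x = ccat (j ↦ piece ⟨x, 1ʲ⟩) K` -/

section CMap

/-- **The concatenation of the pieces `piece ⟨x, 1⁰⟩, …, piece ⟨x, 1^{K-1}⟩`**, `K` read off `x` in
binary by `cnt`, the pieces clipped to `C (|x| + 1)` symbols (a no-op on the intended inputs). [folklore] -/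
noncomputable def cmapF (cnt piece : List Bool → List Bool) (C : ℕ) : List Bool → List Bool :=
  sndPow 2 ∘ foldLoop appF (clipF C piece) X ∘ fanoutFn id (fanoutFn cnt (fun _ => boolPair [] []))

/-- **Value of `cmapF`** when the count is at most `|x|` and the pieces are short. [folklore] -/
theorem cmapF_apply {cnt piece : List Bool → List Bool} {C : ℕ} {x : List Bool} {K : ℕ}
    (hcnt : cnt x = encodeNat K) (hK : K ≤ x.length)
    (hsh : ∀ j, j < K → (piece (boolPair x (ones j))).length ≤ C * (x.length + 1)) :
    cmapF cnt piece C x = ccat (fun j => piece (boolPair x (ones j))) K := by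
  rw [cmapF, Function.comp_apply, Function.comp_apply, fanoutFn_apply, fanoutFn_apply, hcnt,
    show boolPair [] [] = boolPair (ones 0) [] from rfl, id, foldLoop_apply _ _ (by simpa using hK),
    sndPow_succ_boolPair, sndPow_succ_boolPair, sndPow_zero_boolPair,
    foldAcc_clipF (fun j _ hj => hsh j (by omega)), foldAcc_appF]
  simp

/-- `cmapF cnt piece C ∈ FP` for `cnt, piece ∈ FP`. [folklore] -/
theorem cmapF_mem_FP {cnt piece : List Bool → List Bool} (C : ℕ) (hcnt : cnt ∈ FP) (hp : piece ∈ FP) :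
    cmapF cnt piece C ∈ FP :=
  comp_mem_FP (sndPow_mem_FP 2) (comp_mem_FP (foldLoop_clipF_mem_FP C appF_mem_FP length_appF_le hp X)
    (fanoutFn_mem_FP id_mem_FP (fanoutFn_mem_FP hcnt (const_mem_FP _))))

/-- Length of a `ccat` whose pieces below the count are bounded. [folklore] -/
theorem length_ccat_le' (g : ℕ → List Bool) (b : ℕ) : ∀ m : ℕ, (∀ i, i < m → (g i).length ≤ b) →
    (ccat g m).length ≤ m * b
  | 0, _ => by simp
  | m + 1, h => by
    rw [ccat_succ, List.length_append, Nat.succ_mul]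
    exact Nat.add_le_add (length_ccat_le' g b m fun i hi => h i (by omega)) (h m (by omega))

end CMap

/-! ### Row frames: `rowFrF qpA cellF C x = rowFrame n c` -/

section Rows

/-- **The frame of a row of cells**: `⟨⟨1ⁿ, frames of the cells cellF ⟨x, 1ʲ⟩ (j < n)⟩, ε⟩`, with `n`
(in binary and unary) read off the context `qpA x`. [folklore] -/
noncomputable def rowFrF (qpA cellF : List Bool → List Bool) (C : ℕ) : List Bool → List Bool :=
  fanoutFn (fanoutFn (onesN ∘ qpA) (cmapF (encN ∘ qpA) (fanoutFn cellF (fun _ => [])) C)) (fun _ => [])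

/-- **Value of `rowFrF`.** [folklore] -/
theorem rowFrF_apply {qpA cellF : List Bool → List Bool} {C : ℕ} {x : List Bool} (M : Fin n → Fin n → ℤ)
    (c : ℕ → ℤ) (hq : qpA x = ctxOf M) (hn : n ≤ x.length)
    (hcell : ∀ j : Fin n, cellF (boolPair x (ones j)) = cellCode (c j))
    (hsh : ∀ j : Fin n, (frame1 (cellCode (c j))).length ≤ C * (x.length + 1)) :
    rowFrF qpA cellF C x = rowFrame n c := by
  have hc : ∀ j, j < n → (fanoutFn cellF fun _ => []) (boolPair x (ones j)) = frame1 (cellCode (c j)) := by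
    intro j hj
    rw [fanoutFn_apply, hcell ⟨j, hj⟩]; rfl
  rw [rowFrF, fanoutFn_apply, fanoutFn_apply, Function.comp_apply, hq, onesN_ctxOf,
    cmapF_apply (by rw [Function.comp_apply, hq, encN_ctxOf]) hn (fun j hj => by rw [hc j hj]; exact hsh ⟨j, hj⟩),
    rowFrame, frame1, ccat_congr hc]

/-- `rowFrF qpA cellF C ∈ FP`. [folklore] -/
theorem rowFrF_mem_FP {qpA cellF : List Bool → List Bool} (C : ℕ) (hq : qpA ∈ FP) (hc : cellF ∈ FP) :
    rowFrF qpA cellF C ∈ FP :=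
  fanoutFn_mem_FP (fanoutFn_mem_FP (comp_mem_FP accessors_mem_FP.2.1 hq)
    (cmapF_mem_FP C (comp_mem_FP accessors_mem_FP.1 hq) (fanoutFn_mem_FP hc (const_mem_FP _)))) (const_mem_FP _)

/-- Size of a cell frame with magnitude of at most `3 |⟨M⟩| + 1` symbols: `≤ 12 |⟨M⟩| + 34`. [folklore] -/
theorem length_frame1_cellCode_le {L : ℕ} {z : ℤ} (h : (encodeNat z.natAbs).length ≤ 3 * L + 1) :
    (frame1 (cellCode z)).length ≤ 12 * L + 34 := by
  rw [length_frame1, length_cellCode]; omega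

/-- **Size of a row frame**: with cell magnitudes of at most `3 |⟨M⟩| + 1` symbols, a row frame has at
most `43 |⟨M⟩|²` symbols (`n (24 |⟨M⟩| + 72) + 6` with `n ≤ |⟨M⟩|` and `4 ≤ |⟨M⟩|`). [folklore] -/
theorem length_rowFrame_le (M : Fin n → Fin n → ℤ) (c : ℕ → ℤ)
    (h : ∀ j, j < n → (encodeNat (c j).natAbs).length ≤ 3 * codeLen M + 1) :
    (rowFrame n c).length ≤ 43 * codeLen M ^ 2 := by
  set L := codeLen M
  have hcc : (ccat (fun j => frame1 (cellCode (c j))) n).length ≤ n * (12 * L + 34) :=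
    length_ccat_le' _ _ n fun j hj => length_frame1_cellCode_le (h j hj)
  have hn := le_codeLen M
  have h4 := four_le_codeLen M
  rw [rowFrame, length_frame1, length_boolPair]
  simp only [ones, List.length_replicate]
  have h1 : n * (12 * L + 34) ≤ L * (12 * L + 34) := Nat.mul_le_mul_right _ hn
  nlinarith

/-- The cell-frame bound against a context at least `|⟨M⟩|` long (constant `40`). [folklore] -/
theorem frame1_cell_le_ctx {M : Fin n → Fin n → ℤ} {z : ℤ} {x : List Bool}
    (h : (encodeNat z.natAbs).length ≤ 3 * codeLen M + 1) (hx : codeLen M ≤ x.length) :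
    (frame1 (cellCode z)).length ≤ 40 * (x.length + 1) := by
  have := length_frame1_cellCode_le h; nlinarith

/-- Sizes against the padded context: `43 L² ≤ 43 (|x| + 1)`, `43 L³ ≤ …`, `430 L³ ≤ 430 (|x| + 1)` whenever
`|ctx| ≤ |x|`. [folklore] -/
theorem sq_cube_le_ctx (M : Fin n → Fin n → ℤ) {x : List Bool} (hx : (ctxOf M).length ≤ x.length) :
    codeLen M ^ 2 ≤ x.length + 1 ∧ codeLen M ^ 3 ≤ x.length + 1 := by
  have h := codeLen_pow_le_length_ctxOf M
  constructor <;> omega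

end Rows

/-! ### The three row blocks -/

section Blocks

/-- **The block `X`** (on the context): the frames of the rows `i < n` with cells `cellXF`. [folklore] -/
noncomputable def partXF : List Bool → List Bool := cmapF encN (rowFrF fstF cellXF 40) 43

/-- `partXF ctx = partXs M`. [folklore] -/
theorem partXF_ctxOf (M : Fin n → Fin n → ℤ) : partXF (ctxOf M) = partXs M := by
  have hL := codeLen_pow_le_length_ctxOf M
  have hrow : ∀ i, i < n → rowFrF fstF cellXF 40 (boolPair (ctxOf M) (ones i)) = rowFrame n (cellXv M i) := by
    intro i hi
    refine rowFrF_apply M (cellXv M i) (by simp) (by rw [length_boolPair]; have := le_codeLen M; omega)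
      (fun j => cellXF_apply M ⟨i, hi⟩ j) (fun j => frame1_cell_le_ctx ((length_cell_le M).1 ⟨i, hi⟩ j) ?_)
    rw [length_boolPair]; omega
  rw [partXF, cmapF_apply (encN_ctxOf M) ((le_codeLen M).trans hL.1), partXs]
  · exact ccat_congr hrow
  · intro i hi
    rw [hrow i hi]
    have h := length_rowFrame_le M (cellXv M i) (fun j hj => (length_cell_le M).1 ⟨i, hi⟩ ⟨j, hj⟩)
    have := (sq_cube_le_ctx M le_rfl).1
    nlinarith

/-- `partXF ∈ FP`. [folklore] -/
theorem partXF_mem_FP : partXF ∈ FP := cmapF_mem_FP 43 accessors_mem_FP.1 (rowFrF_mem_FP 40 fstF_mem_FP cellXF_mem_FP)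

/-- The pair rows of a fixed `a` (on `⟨ctx, 1ᵃ⟩`): the frames of the rows `(a, b)`, `b < n`. [folklore] -/
noncomputable def rowsPbF : List Bool → List Bool := cmapF (encN ∘ fstF) (rowFrF (fstF ∘ fstF) cellPF 40) 43

/-- Value of `rowsPbF`. [folklore] -/
theorem rowsPbF_apply (M : Fin n → Fin n → ℤ) (a : Fin n) :
    rowsPbF (gv M a) = ccat (fun b => rowFrame n (cellPv M a b)) n := by
  have hL := codeLen_pow_le_length_ctxOf M
  have hlen : (ctxOf M).length ≤ (gv M a).length := by rw [length_boolPair]; omega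
  have hrow : ∀ b, b < n → rowFrF (fstF ∘ fstF) cellPF 40 (boolPair (gv M a) (ones b)) = rowFrame n (cellPv M a b) := by
    intro b hb
    refine rowFrF_apply M (cellPv M a b) (by simp) (by rw [length_boolPair]; have := le_codeLen M; omega)
      (fun j => cellPF_apply M a ⟨b, hb⟩ j) (fun j => frame1_cell_le_ctx ((length_cell_le M).2.1 a ⟨b, hb⟩ j) ?_)
    rw [length_boolPair]; omega
  rw [rowsPbF, cmapF_apply (by simp) ((le_codeLen M).trans (hL.1.trans hlen))]
  · exact ccat_congr hrow
  · intro b hb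
    rw [hrow b hb]
    have h := length_rowFrame_le M (cellPv M a b) (fun j hj => (length_cell_le M).2.1 a ⟨b, hb⟩ ⟨j, hj⟩)
    have := (sq_cube_le_ctx M hlen).1
    nlinarith

/-- **The pair block** (on the context): the pair rows `(a, b)` in row-major order. [folklore] -/
noncomputable def partPF : List Bool → List Bool := cmapF encN rowsPbF 43

/-- `partPF ctx = partPs M`. [folklore] -/
theorem partPF_ctxOf (M : Fin n → Fin n → ℤ) : partPF (ctxOf M) = partPs M := by
  have hL := codeLen_pow_le_length_ctxOf M
  rw [partPF, cmapF_apply (encN_ctxOf M) ((le_codeLen M).trans hL.1), partPs]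
  · exact ccat_congr fun a ha => rowsPbF_apply M ⟨a, ha⟩
  · intro a ha
    rw [show boolPair (ctxOf M) (ones a) = gv M a from rfl, rowsPbF_apply M ⟨a, ha⟩]
    have h := length_ccat_le' (fun b => rowFrame n (cellPv M a b)) (43 * codeLen M ^ 2) n fun b hb =>
      length_rowFrame_le M (cellPv M a b) (fun j hj => (length_cell_le M).2.1 ⟨a, ha⟩ ⟨b, hb⟩ ⟨j, hj⟩)
    have h3 := (sq_cube_le_ctx M le_rfl).2
    have hn := le_codeLen M
    calc (ccat (fun b => rowFrame n (cellPv M a b)) n).length ≤ n * (43 * codeLen M ^ 2) := h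
      _ ≤ codeLen M * (43 * codeLen M ^ 2) := Nat.mul_le_mul_right _ hn
      _ = 43 * codeLen M ^ 3 := by ring
      _ ≤ 43 * ((ctxOf M).length + 1) := by nlinarith

/-- `partPF ∈ FP`. [folklore] -/
theorem partPF_mem_FP : partPF ∈ FP :=
  cmapF_mem_FP 43 accessors_mem_FP.1 (cmapF_mem_FP 43 (comp_mem_FP accessors_mem_FP.1 fstF_mem_FP)
    (rowFrF_mem_FP 40 (comp_mem_FP fstF_mem_FP fstF_mem_FP) cellPF_mem_FP))

/-- The private rows of a fixed `(a, lvl)` (on `⟨⟨ctx, 1ᵃ⟩, 1^{lvl}⟩`): the rows `(a, lvl, l)`, `l < 3`. [folklore] -/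
noncomputable def rowsVlF : List Bool → List Bool :=
  cmapF (fun _ => encodeNat 3) (rowFrF (fstF ∘ fstF ∘ fstF) cellVF 40) 43

/-- Value of `rowsVlF`. [folklore] -/
theorem rowsVlF_apply (M : Fin n → Fin n → ℤ) (a : Fin n) {lvl : ℕ} (hl : lvl ≤ tOf M) :
    rowsVlF (boolPair (gv M a) (ones lvl)) = ccat (fun l => rowFrame n (cellVv M (tOf M) a lvl l)) 3 := by
  have hL := codeLen_pow_le_length_ctxOf M
  have h4 := four_le_codeLen M
  have hlen : (ctxOf M).length ≤ (boolPair (gv M a) (ones lvl)).length := by rw [length_boolPair, length_boolPair]; omega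
  have hrow : ∀ l, l < 3 → rowFrF (fstF ∘ fstF ∘ fstF) cellVF 40 (boolPair (boolPair (gv M a) (ones lvl)) (ones l)) =
      rowFrame n (cellVv M (tOf M) a lvl l) := by
    intro l _
    refine rowFrF_apply M (cellVv M (tOf M) a lvl l) (by simp) ?_ (fun j => cellVF_apply M a j lvl l)
      (fun j => frame1_cell_le_ctx ((length_cell_le M).2.2 a j lvl l hl) ?_)
    · rw [length_boolPair, length_boolPair, length_boolPair]; have := le_codeLen M; omega
    · rw [length_boolPair, length_boolPair, length_boolPair]; omega
  rw [rowsVlF, cmapF_apply rfl (by rw [length_boolPair, length_boolPair]; omega)]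
  · exact ccat_congr hrow
  · intro l hl3
    rw [hrow l hl3]
    have h := length_rowFrame_le M (cellVv M (tOf M) a lvl l) (fun j hj => (length_cell_le M).2.2 a ⟨j, hj⟩ lvl l hl)
    have := (sq_cube_le_ctx M hlen).1
    nlinarith

/-- The private rows of a fixed `a` (on `⟨ctx, 1ᵃ⟩`): the levels `lvl ≤ t`. [folklore] -/
noncomputable def rowsVlvlF : List Bool → List Bool := cmapF (lenBinF ∘ List.cons true ∘ tU ∘ fstF) rowsVlF 129

/-- Value of `rowsVlvlF`. [folklore] -/
theorem rowsVlvlF_apply (M : Fin n → Fin n → ℤ) (a : Fin n) :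
    rowsVlvlF (gv M a) = ccat (fun lvl => ccat (fun l => rowFrame n (cellVv M (tOf M) a lvl l)) 3) (tOf M + 1) := by
  have hL := codeLen_pow_le_length_ctxOf M
  have h4 := four_le_codeLen M
  have hlen : (ctxOf M).length ≤ (gv M a).length := by rw [length_boolPair]; omega
  have hcnt : (lenBinF ∘ List.cons true ∘ tU ∘ fstF) (gv M a) = encodeNat (tOf M + 1) := by simp
  have ht : tOf M + 1 ≤ (gv M a).length := by
    rw [length_boolPair, length_ctxOf, tOf]
    nlinarith
  rw [rowsVlvlF, cmapF_apply hcnt ht]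
  · exact ccat_congr fun lvl hlvl => rowsVlF_apply M a (by omega)
  · intro lvl hlvl
    rw [rowsVlF_apply M a (by omega)]
    have h := length_ccat_le' (fun l => rowFrame n (cellVv M (tOf M) a lvl l)) (43 * codeLen M ^ 2) 3 fun l _ =>
      length_rowFrame_le M _ (fun j hj => (length_cell_le M).2.2 a ⟨j, hj⟩ lvl l (by omega))
    have := (sq_cube_le_ctx M hlen).1
    nlinarith

/-- **The private block** (on the context): the private rows `(a, lvl, l)`. [folklore] -/
noncomputable def partVF : List Bool → List Bool := cmapF encN rowsVlvlF 430

/-- `partVF ctx = partVs M t`. [folklore] -/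
theorem partVF_ctxOf (M : Fin n → Fin n → ℤ) : partVF (ctxOf M) = partVs M (tOf M) := by
  have hL := codeLen_pow_le_length_ctxOf M
  have h4 := four_le_codeLen M
  rw [partVF, cmapF_apply (encN_ctxOf M) ((le_codeLen M).trans hL.1), partVs]
  · exact ccat_congr fun a ha => rowsVlvlF_apply M ⟨a, ha⟩
  · intro a ha
    rw [show boolPair (ctxOf M) (ones a) = gv M a from rfl, rowsVlvlF_apply M ⟨a, ha⟩]
    have h := length_ccat_le' (fun lvl => ccat (fun l => rowFrame n (cellVv M (tOf M) a lvl l)) 3)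
      (3 * (43 * codeLen M ^ 2)) (tOf M + 1) fun lvl hlvl =>
        length_ccat_le' _ _ 3 fun l _ => length_rowFrame_le M _
          (fun j hj => (length_cell_le M).2.2 ⟨a, ha⟩ ⟨j, hj⟩ lvl l (by omega))
    have h3 := (sq_cube_le_ctx M le_rfl).2
    have ht : tOf M + 1 ≤ 10 * codeLen M / 3 := by rw [tOf]; omega
    calc (ccat (fun lvl => ccat (fun l => rowFrame n (cellVv M (tOf M) a lvl l)) 3) (tOf M + 1)).length
        ≤ (tOf M + 1) * (3 * (43 * codeLen M ^ 2)) := h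
      _ ≤ (10 * codeLen M) * (43 * codeLen M ^ 2) := by rw [tOf]; nlinarith
      _ = 430 * codeLen M ^ 3 := by ring
      _ ≤ 430 * ((ctxOf M).length + 1) := by nlinarith

/-- `partVF ∈ FP`. [folklore] -/
theorem partVF_mem_FP : partVF ∈ FP :=
  cmapF_mem_FP 430 accessors_mem_FP.1 (cmapF_mem_FP 129
    (comp_mem_FP lenBinF_mem_FP (comp_mem_FP (cons_mem_FP true) (comp_mem_FP accessors_mem_FP.2.2.2 fstF_mem_FP)))
    (cmapF_mem_FP 43 (const_mem_FP _) (rowFrF_mem_FP 40 (comp_mem_FP fstF_mem_FP (comp_mem_FP fstF_mem_FP fstF_mem_FP))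
      cellVF_mem_FP)))

end Blocks

/-! ### The instance code `x₀` and the outcome code `y₀`; the map `bPre` -/

section Pre

/-- `1ᵉ`, `e = n² + 3 n (t + 1)` (on the context). [folklore] -/
noncomputable def eU : List Bool → List Bool :=
  appF ∘ fanoutFn (umulFn ∘ fanoutFn onesN onesN) (umulFn ∘ fanoutFn onesN (onesMulFn 3 ∘ List.cons true ∘ tU))

/-- `eU ctx = 1ᵉ`. [folklore] -/
theorem eU_ctxOf (M : Fin n → Fin n → ℤ) : eU (ctxOf M) = ones (gramExtra n (tOf M)) := by
  have h3 : (onesMulFn 3 ∘ List.cons true ∘ tU) (ctxOf M) = ones (3 * (tOf M + 1)) := by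
    simp [onesMulFn, ones]
  rw [eU, Function.comp_apply, fanoutFn_apply, Function.comp_apply, Function.comp_apply, fanoutFn_apply,
    fanoutFn_apply, h3, onesN_ctxOf, umulFn_boolPair, umulFn_boolPair, appF_boolPair, gramExtra]
  simp only [ones, ← List.replicate_add]
  congr 1; ring

/-- `eU ∈ FP`. [folklore] -/
theorem eU_mem_FP : eU ∈ FP :=
  comp_mem_FP appF_mem_FP (fanoutFn_mem_FP (comp_mem_FP umulFn_mem_FP (fanoutFn_mem_FP accessors_mem_FP.2.1 accessors_mem_FP.2.1))
    (comp_mem_FP umulFn_mem_FP (fanoutFn_mem_FP accessors_mem_FP.2.1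
      (comp_mem_FP (onesMulFn_mem_FP 3) (comp_mem_FP (cons_mem_FP true) accessors_mem_FP.2.2.2)))))

/-- The body of the row list: the three blocks. [folklore] -/
noncomputable def bodyRowsF : List Bool → List Bool := appF ∘ fanoutFn (appF ∘ fanoutFn partXF partPF) partVF

/-- **The instance code** `x₀ = ⟨bin n, ⟨bin e, ⟨bin t, ⟨1^{n+e}, rows⟩⟩⟩⟩` (on the context). [folklore] -/
noncomputable def x0F : List Bool → List Bool :=
  fanoutFn encN (fanoutFn (lenBinF ∘ eU) (fanoutFn (lenBinF ∘ tU) (fanoutFn (appF ∘ fanoutFn onesN eU) bodyRowsF)))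

/-- **`x0F ctx` is the instance code at precision `t = 3 |⟨M⟩|`.** [folklore] -/
theorem x0F_ctxOf (M : Fin n → Fin n → ℤ) : x0F (ctxOf M) = gramInstanceCode (Matrix.of M) (tOf M) := by
  rw [gramInstanceCode_eq]
  simp only [x0F, bodyRowsF, fanoutFn_apply, Function.comp_apply, encN_ctxOf, eU_ctxOf, lenBinF_apply, tU_ctxOf,
    onesN_ctxOf, appF_boolPair, partXF_ctxOf, partPF_ctxOf, partVF_ctxOf, ones, List.length_replicate,
    ← List.replicate_add]

/-- `x0F ∈ FP`. [folklore] -/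
theorem x0F_mem_FP : x0F ∈ FP :=
  fanoutFn_mem_FP accessors_mem_FP.1 (fanoutFn_mem_FP (comp_mem_FP lenBinF_mem_FP eU_mem_FP)
    (fanoutFn_mem_FP (comp_mem_FP lenBinF_mem_FP accessors_mem_FP.2.2.2)
      (fanoutFn_mem_FP (comp_mem_FP appF_mem_FP (fanoutFn_mem_FP accessors_mem_FP.2.1 eU_mem_FP))
        (comp_mem_FP appF_mem_FP (fanoutFn_mem_FP (comp_mem_FP appF_mem_FP (fanoutFn_mem_FP partXF_mem_FP partPF_mem_FP))
          partVF_mem_FP)))))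

/-- **The outcome code** `y₀ = ⟨1ⁿ, frames of bin 0, …, bin (n-1)⟩` (on the context). [folklore] -/
noncomputable def y0F : List Bool → List Bool :=
  fanoutFn onesN (cmapF encN (fanoutFn (lenBinF ∘ sndF) (fun _ => [])) 4)

/-- **`y0F ctx` is the outcome code.** [folklore] -/
theorem y0F_ctxOf (M : Fin n → Fin n → ℤ) : y0F (ctxOf M) = diagOutcomeCode n (tOf M) := by
  have hL := codeLen_pow_le_length_ctxOf M
  have hn := le_codeLen M
  rw [diagOutcomeCode_eq, y0F, fanoutFn_apply, onesN_ctxOf, cmapF_apply (encN_ctxOf M) (hn.trans hL.1)]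
  · apply congrArg (boolPair (ones n))
    exact ccat_congr fun i _ => by simp [frame1]
  · intro i hi
    have h1 : (encodeNat i).length ≤ i := by
      rw [TM2Pass.length_encodeNat_eq_size]; exact Nat.size_le.2 (Nat.lt_two_pow_self)
    simp only [fanoutFn_apply, Function.comp_apply, sndF_boolPair, lenBinF_apply, List.length_replicate, length_boolPair,
      List.length_nil]
    omega

/-- `y0F ∈ FP`. [folklore] -/
theorem y0F_mem_FP : y0F ∈ FP :=
  fanoutFn_mem_FP accessors_mem_FP.2.1 (cmapF_mem_FP 4 accessors_mem_FP.1
    (fanoutFn_mem_FP (comp_mem_FP lenBinF_mem_FP sndF_mem_FP) (const_mem_FP _)))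

/-- **The reduction's pre-processing map** `q ↦ ⟨x₀, y₀⟩`: pad the matrix code to its context, then
emit the instance and outcome codes (AA13 p. 178: "Let us feed `A` as input to `𝒪` and consider the
probability `p_A` that `𝒪` outputs `1_n`"). [cite: AaronsonArkhipovToC2013, proof of Thm. 1.1 (p. 178)] -/
noncomputable def bPre : List Bool → List Bool := fanoutFn x0F y0F ∘ mkCtx

/-- **`bPre` on the matrix code of the query**: the instance of `X` at precision `3 |⟨X⟩|` and the planted
outcome. [cite: AaronsonArkhipovToC2013, proof of Thm. 1.1 (p. 178)] -/
theorem bPre_apply (M : Fin n → Fin n → ℤ) :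
    bPre (qcode M) = boolPair (gramInstanceCode (Matrix.of M) (tOf M)) (diagOutcomeCode n (tOf M)) := by
  rw [bPre, Function.comp_apply, mkCtx_qcode, fanoutFn_apply, x0F_ctxOf, y0F_ctxOf]

/-- **`bPre ∈ FP`.** [cite: AroraBarak2009, §1.3 (polynomial time is closed under composition and bounded loops)] -/
theorem bPre_mem_FP : bPre ∈ FP := comp_mem_FP (fanoutFn_mem_FP x0F_mem_FP y0F_mem_FP) mkCtx_mem_FP

end Pre


/-! ### The count query: `bQuery qA cS ⟨⟨q, 1ᵏ⟩, u⟩ = ⟨⟨x₀y₀, 1ᵐ, 1¹, 1ᵏ⟩, u ↾ ℓ'⟩` -/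

section Query

/-- The matrix code `q` of a `Per²`-query `w = ⟨⟨q, 1ᵏ⟩, u⟩`. [folklore] -/
def qW : List Bool → List Bool := fstF ∘ fstF
/-- `1ᵏ` of `w`. [folklore] -/
def kW : List Bool → List Bool := sndF ∘ fstF
/-- The coins `u` of `w`. [folklore] -/
def uW : List Bool → List Bool := sndF
/-- `⟨x₀, y₀⟩ = bPre q` from `w`. [folklore] -/
noncomputable def preW : List Bool → List Bool := bPre ∘ qW
/-- `1ᵐ`, `m = qA |x₀|`: the sampler's coin count on the instance. [folklore] -/
noncomputable def mW (qA : Polynomial ℕ) : List Bool → List Bool := polyFn qA ∘ fstF ∘ preW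
/-- `1^{ℓ'}`, `ℓ' = cS (|⟨x₀,y₀⟩| + m + 1 + k)`: the counter's coin count. [folklore] -/
noncomputable def ellW (qA cS : Polynomial ℕ) : List Bool → List Bool :=
  polyFn cS ∘ appF ∘ fanoutFn (appF ∘ fanoutFn preW (mW qA)) (List.cons true ∘ kW)

/-- **The count query** assembled from `w`: `countQuery ⟨x₀,y₀⟩ m 1 k (u ↾ ℓ')`. (AA13 p. 178: "by
Theorem 4.1, we can approximate `p_A`".) [cite: AaronsonArkhipovToC2013, proof of Thm. 1.1 (p. 178)] -/
noncomputable def bQuery (qA cS : Polynomial ℕ) : List Bool → List Bool :=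
  fanoutFn (fanoutFn preW (fanoutFn (mW qA) (fanoutFn (fun _ => [true]) kW))) (takeFn ∘ fanoutFn (ellW qA cS) uW)

/-- The sampler's coin count on the instance of `M`. [folklore] -/
def mOf (qA : Polynomial ℕ) (M : Fin n → Fin n → ℤ) : ℕ := qA.eval (gramInstanceCode (Matrix.of M) (tOf M)).length

/-- The counter's coin count for the query `⟨⟨⟨M⟩, 1ᵏ⟩, ·⟩`. [folklore] -/
noncomputable def ellOf (qA cS : Polynomial ℕ) (M : Fin n → Fin n → ℤ) (k : ℕ) : ℕ :=
  cS.eval ((bPre (qcode M)).length + mOf qA M + 1 + k)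

/-- **`bQuery` on a well-formed `Per²`-query.** [cite: AaronsonArkhipovToC2013, proof of Thm. 1.1 (p. 178)] -/
theorem bQuery_apply (qA cS : Polynomial ℕ) (M : Fin n → Fin n → ℤ) (k : ℕ) (u : List Bool) :
    bQuery qA cS (perSqQuery M k u) =
      countQuery (bPre (qcode M)) (mOf qA M) 1 k (u.take (ellOf qA cS M k)) := by
  have hq : qW (perSqQuery M k u) = qcode M := by simp [qW, perSqQuery]
  have hk : kW (perSqQuery M k u) = ones k := by simp [kW, perSqQuery, Complexity.unaryEncodeNat_eq_replicate]
  have hu : uW (perSqQuery M k u) = u := by simp [uW, perSqQuery]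
  have hpre : preW (perSqQuery M k u) = bPre (qcode M) := by rw [preW, Function.comp_apply, hq]
  have hm : mW qA (perSqQuery M k u) = ones (mOf qA M) := by
    rw [mW, Function.comp_apply, Function.comp_apply, hpre, bPre_apply, fstF_boolPair, polyFn_apply, mOf]
  have hlen : ((appF ∘ fanoutFn (appF ∘ fanoutFn preW (mW qA)) (List.cons true ∘ kW)) (perSqQuery M k u)).length =
      (bPre (qcode M)).length + mOf qA M + 1 + k := by
    simp only [Function.comp_apply, fanoutFn_apply, hpre, hm, hk, appF_boolPair, List.length_append, List.length_cons,
      ones, List.length_replicate]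
    omega
  have hell : ellW qA cS (perSqQuery M k u) = ones (ellOf qA cS M k) := by
    rw [ellW, Function.comp_apply, polyFn_apply, hlen, ellOf]
  rw [bQuery, fanoutFn_apply, fanoutFn_apply, fanoutFn_apply, fanoutFn_apply, hpre, hm, hk, Function.comp_apply,
    fanoutFn_apply, hell, hu, takeFn_boolPair, countQuery, Complexity.unaryEncodeNat_eq_replicate,
    Complexity.unaryEncodeNat_eq_replicate, Complexity.unaryEncodeNat_eq_replicate]
  simp [ones]

/-- **`bQuery ∈ FP`.** [cite: AroraBarak2009, §1.3] -/
theorem bQuery_mem_FP (qA cS : Polynomial ℕ) : bQuery qA cS ∈ FP := by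
  have hq : qW ∈ FP := comp_mem_FP fstF_mem_FP fstF_mem_FP
  have hk : kW ∈ FP := comp_mem_FP sndF_mem_FP fstF_mem_FP
  have hpre : preW ∈ FP := comp_mem_FP bPre_mem_FP hq
  have hm : mW qA ∈ FP := comp_mem_FP (polyFn_mem_FP qA) (comp_mem_FP fstF_mem_FP hpre)
  have hell : ellW qA cS ∈ FP := comp_mem_FP (polyFn_mem_FP cS) (comp_mem_FP appF_mem_FP
    (fanoutFn_mem_FP (comp_mem_FP appF_mem_FP (fanoutFn_mem_FP hpre hm)) (comp_mem_FP (cons_mem_FP true) hk)))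
  exact fanoutFn_mem_FP (fanoutFn_mem_FP hpre (fanoutFn_mem_FP hm (fanoutFn_mem_FP (const_mem_FP _) hk)))
    (comp_mem_FP takeFn_mem_FP (fanoutFn_mem_FP hell sndF_mem_FP))

end Query

/-! ### The rescaling: `bPost qA ⟨w, a⟩ = bin ⌈(N / 2ᵐ) 4^{tn} n!⌉`, `N = decodeNat a` -/

section Post

/-- `n!` from the matrix code `q` (fold of `prodFn` over `bin (i+1)`, `i < n`). [folklore] -/
noncomputable def factF : List Bool → List Bool :=
  sndPow 2 ∘ foldLoop prodFn (clipF 1 (lenBinF ∘ List.cons true ∘ sndF)) X ∘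
    fanoutFn id (fanoutFn fstF (fun _ => boolPair [] [true]))

/-- `factF ⟨M⟩ = bin n!`. [folklore] -/
theorem factF_apply (M : Fin n → Fin n → ℤ) : factF (qcode M) = encodeNat n.factorial := by
  have hinit : fanoutFn id (fanoutFn fstF (fun _ => boolPair [] [true])) (qcode M) =
      boolPair (qcode M) (boolPair (encodeNat n) (boolPair (ones 0) (encodeNat 1))) := by
    rw [fanoutFn_apply, fanoutFn_apply, id, show fstF (qcode M) = encodeNat n by rw [qcode_eq, fstF_boolPair]]; rfl
  have hk : n ≤ X.eval (qcode M).length := by simpa [length_qcode] using le_codeLen M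
  rw [factF, Function.comp_apply, Function.comp_apply, hinit, foldLoop_apply _ _ hk, sndPow_succ_boolPair,
    sndPow_succ_boolPair, sndPow_zero_boolPair, foldAcc_clipF, foldAcc_prodFn, one_mul, ← Finset.prod_range_add_one_eq_factorial]
  · apply congrArg encodeNat
    exact Finset.prod_congr rfl fun j _ => by simp
  · intro j _ hj
    have h1 : (encodeNat (j + 1)).length ≤ j + 1 := by
      rw [TM2Pass.length_encodeNat_eq_size]; exact Nat.size_le.2 (Nat.lt_two_pow_self)
    have h2 := le_codeLen M
    simp only [Function.comp_apply, sndF_boolPair, lenBinF_apply, List.length_cons, List.length_replicate, length_qcode]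
    omega

/-- `factF ∈ FP`. [folklore] -/
theorem factF_mem_FP : factF ∈ FP :=
  comp_mem_FP (sndPow_mem_FP 2) (comp_mem_FP (foldLoop_clipF_mem_FP 1 prodFn_mem_FP length_prodFn_le
    (comp_mem_FP lenBinF_mem_FP (comp_mem_FP (cons_mem_FP true) sndF_mem_FP)) X)
    (fanoutFn_mem_FP id_mem_FP (fanoutFn_mem_FP fstF_mem_FP (const_mem_FP _))))

/-- On `z = ⟨w, a⟩`: the query `w`. [folklore] -/
def wZ : List Bool → List Bool := fstF
/-- On `z`: the counter's answer `a`. [folklore] -/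
def aZ : List Bool → List Bool := sndF
/-- On `z`: `1ⁿ`. [folklore] -/
def nUZ : List Bool → List Bool := fstF ∘ sndF ∘ qW ∘ wZ
/-- On `z`: `1ᵗ`. [folklore] -/
noncomputable def tUZ : List Bool → List Bool := polyFn (3 * X) ∘ qW ∘ wZ
/-- On `z`: `bin 4^{tn} = 0^{2tn} 1`. [folklore] -/
noncomputable def pow4tnF : List Bool → List Bool :=
  appF ∘ fanoutFn (Kannan.zerosFn ∘ umulFn ∘ fanoutFn (onesMulFn 2 ∘ tUZ) nUZ) (fun _ => [true])
/-- On `z`: `bin (N · 4^{tn} · n!)`, `N = decodeNat a`. [folklore] -/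
noncomputable def KF : List Bool → List Bool :=
  prodFn ∘ fanoutFn (prodFn ∘ fanoutFn (canonF ∘ aZ) pow4tnF) (factF ∘ qW ∘ wZ)

/-- **The post-processing map** `⟨w, a⟩ ↦ bin ⌈(N / 2ᵐ) · 4^{tn} · n!⌉` (eq. (4.23) inverted: the
probability estimate `N / 2ᵐ` rescaled to an estimate of `Per(X)²`), computed as
`bin ((K + (2ᵐ - 1)) / 2ᵐ)` with `K = N 4^{tn} n!` — add `1ᵐ` read as a numeral, drop `m` bits.
[cite: AaronsonArkhipovToC2013, proof of Thm. 1.1, eq. (4.23) (p. 178)] -/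
noncomputable def bPost (qA : Polynomial ℕ) : List Bool → List Bool :=
  norm ∘ dropFn ∘ fanoutFn (mW qA ∘ wZ) (addFn ∘ fanoutFn KF (mW qA ∘ wZ))

/-- The ceiling of a division by a power of two, in naturals: `⌈K / 2ᵐ⌉ = (K + 2ᵐ - 1) / 2ᵐ`. [folklore] -/
theorem nat_ceil_div_two_pow (K m : ℕ) : ⌈(K : ℚ) / 2 ^ m⌉₊ = (K + 2 ^ m - 1) / 2 ^ m := by
  have hD0 : 0 < 2 ^ m := Nat.two_pow_pos m
  set D : ℕ := 2 ^ m with hD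
  set q : ℕ := (K + D - 1) / D with hq
  set P : ℕ := D * q with hP
  have hdm : P + (K + D - 1) % D = K + D - 1 := Nat.div_add_mod (K + D - 1) D
  have hml : (K + D - 1) % D < D := Nat.mod_lt _ hD0
  have hKP : K ≤ P := by omega
  have hcast : ((2 : ℚ) ^ m) = (D : ℚ) := by rw [hD]; push_cast; rfl
  have hDq : (0 : ℚ) < D := by exact_mod_cast hD0
  rw [hcast]
  rcases Nat.eq_zero_or_pos q with hq0 | hq0
  · have hP0 : P = 0 := by rw [hP, hq0, mul_zero]
    have hK : K = 0 := by omega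
    rw [hK, Nat.cast_zero, zero_div, Nat.ceil_zero, hq0]
  · have hPD : D ≤ P := by rw [hP]; exact Nat.le_mul_of_pos_right D hq0
    have hlt : (q - 1) * D < K := by
      have : (q - 1) * D = P - D := by rw [hP, Nat.mul_comm, Nat.mul_sub_one]
      omega
    rw [Nat.ceil_eq_iff hq0.ne']
    constructor
    · rw [lt_div_iff₀ hDq]; exact_mod_cast hlt
    · rw [div_le_iff₀ hDq]; exact_mod_cast (show K ≤ q * D by rw [Nat.mul_comm]; exact hKP)

/-- **`bPost` on a well-formed query and an arbitrary answer string `a`**: the rescaled estimate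
`bosonRescale n t (decodeNat a) m` in binary. [cite: AaronsonArkhipovToC2013, proof of Thm. 1.1, eq. (4.23) (p. 178)] -/
theorem bPost_apply (qA : Polynomial ℕ) (M : Fin n → Fin n → ℤ) (k : ℕ) (u a : List Bool) :
    bPost qA (boolPair (perSqQuery M k u) a) = encodeNat (bosonRescale n (tOf M) (decodeNat a) (mOf qA M)) := by
  set m := mOf qA M with hm_def
  have hq : (qW ∘ wZ) (boolPair (perSqQuery M k u) a) = qcode M := by simp [qW, wZ, perSqQuery]
  have hm : (mW qA ∘ wZ) (boolPair (perSqQuery M k u) a) = ones m := by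
    have : qW (perSqQuery M k u) = qcode M := by simp [qW, perSqQuery]
    rw [Function.comp_apply, wZ, fstF_boolPair, mW, Function.comp_apply, Function.comp_apply, preW, Function.comp_apply,
      this, bPre_apply, fstF_boolPair, polyFn_apply, hm_def, mOf]
  have hn : nUZ (boolPair (perSqQuery M k u) a) = ones n := by
    rw [nUZ, Function.comp_apply, Function.comp_apply, hq, qcode_eq]; simp
  have ht : tUZ (boolPair (perSqQuery M k u) a) = ones (tOf M) := by
    rw [tUZ, Function.comp_apply, hq, polyFn_apply, length_qcode, tOf]; simp
  have h4 : pow4tnF (boolPair (perSqQuery M k u) a) = encodeNat (4 ^ (tOf M * n)) := by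
    rw [show (4 : ℕ) ^ (tOf M * n) = 2 ^ (2 * tOf M * n) by
      rw [show (4 : ℕ) = 2 ^ 2 by norm_num, ← pow_mul, mul_assoc], Com.encodeNat_two_pow]
    simp [pow4tnF, hn, ht, onesMulFn, ones]
  have hf : (factF ∘ qW ∘ wZ) (boolPair (perSqQuery M k u) a) = encodeNat n.factorial := by
    rw [Function.comp_apply, hq, factF_apply]
  have ha : (canonF ∘ aZ) (boolPair (perSqQuery M k u) a) = canonF a := by simp [aZ]
  have hK : KF (boolPair (perSqQuery M k u) a) = encodeNat (decodeNat a * 4 ^ (tOf M * n) * n.factorial) := by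
    rw [KF, Function.comp_apply, fanoutFn_apply, hf, Function.comp_apply, fanoutFn_apply, ha, h4, prodFn_boolPair,
      prodFn_boolPair, bitsToNat_canonF, bitsToNat_encodeNat, bitsToNat_encodeNat, bitsToNat_encodeNat]
  rw [bPost, Function.comp_apply, Function.comp_apply, fanoutFn_apply, hm, Function.comp_apply,
    fanoutFn_apply, hK, hm, addFn_boolPair, bitsToNat_encodeNat, bitsToNat_ones, dropFn_boolPair, norm_eq_encodeNat,
    bitsToNat_drop, bosonRescale, nat_ceil_div_two_pow, bitsToNat_encodeNat]
  simp only [ones, List.length_replicate]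
  apply congrArg encodeNat
  rw [← Nat.add_sub_assoc Nat.one_le_two_pow, Nat.mul_assoc]

/-- **`bPost qA ∈ FP`.** [cite: AroraBarak2009, §1.3] -/
theorem bPost_mem_FP (qA : Polynomial ℕ) : bPost qA ∈ FP := by
  have hq : (qW ∘ wZ) ∈ FP := comp_mem_FP (comp_mem_FP fstF_mem_FP fstF_mem_FP) fstF_mem_FP
  have hm : (mW qA ∘ wZ) ∈ FP :=
    comp_mem_FP (comp_mem_FP (polyFn_mem_FP qA) (comp_mem_FP fstF_mem_FP (comp_mem_FP bPre_mem_FP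
      (comp_mem_FP fstF_mem_FP fstF_mem_FP)))) fstF_mem_FP
  have hn : nUZ ∈ FP := comp_mem_FP fstF_mem_FP (comp_mem_FP sndF_mem_FP hq)
  have ht : tUZ ∈ FP := comp_mem_FP (polyFn_mem_FP _) hq
  have h4 : pow4tnF ∈ FP := comp_mem_FP appF_mem_FP (fanoutFn_mem_FP (comp_mem_FP Kannan.zerosFn_mem_FP
    (comp_mem_FP umulFn_mem_FP (fanoutFn_mem_FP (comp_mem_FP (onesMulFn_mem_FP 2) ht) hn))) (const_mem_FP _))
  have hK : KF ∈ FP := comp_mem_FP prodFn_mem_FP (fanoutFn_mem_FP (comp_mem_FP prodFn_mem_FP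
    (fanoutFn_mem_FP (comp_mem_FP canonF_mem_FP sndF_mem_FP) h4)) (comp_mem_FP factF_mem_FP hq))
  exact comp_mem_FP norm_mem_FP (comp_mem_FP dropFn_mem_FP (fanoutFn_mem_FP hm (comp_mem_FP addFn_mem_FP (fanoutFn_mem_FP hK hm))))

end Post

end BosonFP

end Literature.Computability.QuantumComplexity
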